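import Literature.NumberTheory.Transcendental.DeRhamTheoremProofs
import Literature.NumberTheory.Transcendental.FormIntegrationStokes
import Literature.NumberTheory.Transcendental.FormIntegrationPositivity
import Literature.NumberTheory.Transcendental.FormIntegrationPullbackCharts
import Literature.Geometry.Kaehler.ManifoldFormsPullback
import Literature.AlgebraicTopology.SingularHomology.OrientationProofs
import Literature.AlgebraicTopology.SingularHomology.FundamentalClassExistence
import Literature.AlgebraicTopology.SingularHomology.FundamentalClassProofs
import Literature.AlgebraicTopology.SingularHomology.IntegralClassRingChange
import Literature.AlgebraicTopology.SingularHomology.HomologyRingChange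
import Literature.AlgebraicTopology.SingularHomology.UniversalCoefficientsField
import HarnessLib

/-!
# The de Rham class of a nowhere-vanishing top form pairs non-trivially with the fundamental class

Topic `Literature/Geometry/Manifold` (de Rham theory ↔ singular homology). For a closed connected
smooth `n`-manifold `M` (charted on `ℝⁿ`) with ANY homological `ℤ`-orientation `μ` and fundamental
class `[M] = μ.fundamentalClass ∈ Hₙ(M; ℤ)`, and the tree's de Rham isomorphism by integration
over smooth simplices `e_M = integrationDeRhamIsoFamily` (`H^k_dR(M) ≃ Hᵏ(M; ℝ)`, de Rham 1931;
Lee (2013), Thm. 18.14), we prove: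

* `integrationDeRhamIsoFamily_map_of_contMDiff` — **naturality of `e` for `C^∞` maps between
  manifolds with different model spaces** (Lee (2013), Thm. 18.14; the tree's
  `integrationDeRhamIsoFamily_isNatural` is the equal-model case, same proof).
* `MForm.not_mem_exactSmoothForms_of_forall_ne_zero` — **a nowhere-vanishing smooth top form on a
  compact manifold is not exact** (it orients `M` by its own ray; its integral for that
  orientation is positive, Lee (2013), Prop. 15.5 & 16.6(c), while exact forms integrate to zero by
  Stokes, Cor. 16.13 — the tree's `MForm.integral_pos_of_sign_mul_apply_nonneg` and
  `MForm.integral_eq_zero_of_mem_exactSmoothForms_holds`).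
* `kroneckerPairing_ringChange_coeffChange` — `⟨β ⊗ 1, z ⊗ 1⟩ = ⟨β, z⟩` for the change of
  coefficients `ℤ → K` (Hatcher (2002), §3.1 p. 198), on classes.
* `coeffChange_fundamentalClass_ne_zero`, `finrank_singularHomology_top_eq_one`,
  `eq_zero_of_kroneckerPairing_coeffChange_fundamentalClass_eq_zero` — over a field `K` of
  characteristic zero, `[M] ⊗ 1 ≠ 0` spans the line `Hₙ(M; K)` (Hatcher (2002), Thm. 3.26(a) for
  the `K`-orientation `μ ⊗ 1`, p. 235), hence **a class `a ∈ Hⁿ(M; K)` with `⟨a, [M] ⊗ 1⟩ = 0`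
  is zero** (universal coefficients over a field, Thm. 3.2 / p. 198).
* `kroneckerPairing_integrationDeRham_fundamentalClass_ne_zero` — **for a nowhere-vanishing
  smooth closed top form `t`, `⟨e_M [t], [M] ⊗ 1⟩ ≠ 0`** (Bott–Tu (1982), §I.5–6 / Lee (2013),
  Thm. 17.31 with Thm. 18.14: `∫_M : Hⁿ_dR(M) ≅ ℝ` and `Hⁿ(M; ℝ)` is detected by `[M]`). The
  statement is SIGN-FREE — it holds for both `ℤ`-orientations `±μ` — which is the form needed
  downstream: the tree's reference generator of `Hₙ(ℝⁿ | 0; ℤ)` is a `Classical.choice`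
  (`HomologicalOrientationOfSmooth.gen0`), so the sign of the pairing for a given smooth
  orientation is not decidable in the tree.
* `kroneckerPairing_integrationDeRham_map_fundamentalClass_ne_zero`,
  `map_fundamentalClass_not_mem_torsion` — the mapped form: for a `C^∞` map `f : S → N` from a
  closed connected `k`-manifold and a closed `k`-form `s` on `N` whose pull-back `f^* s` vanishes
  nowhere, `⟨e_N [s], f_* ([S] ⊗ 1)⟩ = ⟨e_S [f^* s], [S] ⊗ 1⟩ ≠ 0`; in particular
  **`f_* [S] ∈ Hₖ(N; ℤ)` is not a torsion class** (McDuff–Salamon (2017), Ex. 4.4.5 / proof of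
  Thm. 13.3.11: a symplectic surface has `∫_Σ ω > 0`, hence a non-torsion class).

Everything is proved; no definitions, no named facts. The first two results and the surface case
of the detection lemma were first written (same proofs) in the Summits file
`Summits/SmoothPoincare4/SmoothPoincare4/Theorems/SymplecticOrigamiNoGenusTwoDoorStubRankOneFlatComplement.lean`
(namespace `Summit.…CanonicalCapFilling`), which `Literature/` cannot import; they are re-established
here in library form.

## References

* J. M. Lee, *Introduction to Smooth Manifolds*, 2nd ed., GTM 218 (2013), Prop. 15.5, Prop. 16.6,
  Cor. 16.13, Thm. 17.31, Thm. 18.14. [LeeSmoothManifolds2013]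
* R. Bott, L. W. Tu, *Differential Forms in Algebraic Topology*, GTM 82 (1982), §I.5–6.
  [BottTu1982Forms]
* A. Hatcher, *Algebraic Topology*, CUP (2002), §3.1 Thm. 3.2 and p. 198; §3.3 Thm. 3.26, p. 235.
  [HatcherAT2002]
* D. McDuff, D. Salamon, *Introduction to Symplectic Topology*, 3rd ed., OUP (2017), Ex. 4.4.5,
  proof of Thm. 13.3.11. [McDuffSalamon2017]
-/

noncomputable section

open scoped Manifold ContDiff Topology
open Set Function Module
open Literature.AlgebraicTopology.SingularHomology Literature.Geometry.Kaehler
  Literature.NumberTheory.Transcendental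

namespace Literature.Geometry.Manifold

/-! ### Naturality of the integration isomorphisms across model spaces -/

section DeRhamNatural

open CategoryTheory

-- see "Implementation notes" in `…SingularHomology.SingularChainsConcrete`
set_option backward.isDefEq.respectTransparency false

universe u

variable {E : Type u} [NormedAddCommGroup E] [NormedSpace ℝ E] [FiniteDimensional ℝ E]
  {E' : Type u} [NormedAddCommGroup E'] [NormedSpace ℝ E'] [FiniteDimensional ℝ E']
  {M : Type u} [TopologicalSpace M] [ChartedSpace E M] [IsManifold 𝓘(ℝ, E) ∞ M] [T2Space M]
  [SecondCountableTopology M] [LocallyCompactSpace M]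
  {N : Type u} [TopologicalSpace N] [ChartedSpace E' N] [IsManifold 𝓘(ℝ, E') ∞ N] [T2Space N]
  [SecondCountableTopology N] [LocallyCompactSpace N]

/-- **Naturality of the de Rham comparison isomorphism under `C^∞` maps between manifolds with
possibly different (finite-dimensional) model spaces**: `H(f^*) ≫ comparison_M = comparison_N ≫ f^*`
(Lee (2013), Thm. 18.14; the tree's `homologyMap_pullbackUniv_comp_deRhamComparisonIso` is the
equal-model case, with the same proof). [cite: LeeSmoothManifolds2013, Thm. 18.14] -/
theorem homologyMap_pullbackUniv_comp_deRhamComparisonIso_of_contMDiff {f : M → N}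
    (hf : ContMDiff 𝓘(ℝ, E) 𝓘(ℝ, E') ∞ f) (k : ℕ) :
    HomologicalComplex.homologyMap (localDeRhamComplex.pullbackUniv 𝓘(ℝ, E) hf) k ≫
        (deRhamComparisonIso 𝓘(ℝ, E) M k).hom =
      (deRhamComparisonIso 𝓘(ℝ, E') N k).hom ≫ singularCohomology.map ℝ ℝ ⟨f, hf.continuous⟩ k := by
  haveI := isIso_homologyMap_toSmoothAll (I := 𝓘(ℝ, E)) (M := M) k
  rw [← cancel_mono (HomologicalComplex.homologyMap (singIso M).hom k ≫
      HomologicalComplex.homologyMap (toSmoothAll 𝓘(ℝ, E) M) k),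
    Category.assoc, deRhamComparisonIso_hom_comp, ← HomologicalComplex.homologyMap_comp,
    pullbackUniv_comp_deRhamMap, HomologicalComplex.homologyMap_comp]
  change _ = _ ≫
    HomologicalComplex.homologyMap (singularCochainComplex.map ℝ ℝ ⟨f, hf.continuous⟩) k ≫ _ ≫ _
  rw [← HomologicalComplex.homologyMap_comp_assoc, singIso_hom_naturality,
    HomologicalComplex.homologyMap_comp_assoc,
    ← HomologicalComplex.homologyMap_comp (dualMap ℝ realCoeff
      (csingularChainComplex.map ℝ ℝ ⟨f, hf.continuous⟩)) (toSmoothAll 𝓘(ℝ, E) M) k,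
    ← toSmoothAll_naturality hf, HomologicalComplex.homologyMap_comp,
    deRhamComparisonIso_hom_comp_assoc]

/-- **The integration isomorphisms `H^k_dR ≃ Hᵏ(·; ℝ)` are natural for `C^∞` maps between
manifolds with different model spaces**: `e_M (f^* c) = f^* (e_N c)` (Lee (2013), Thm. 18.14; the
tree's `integrationDeRhamIsoFamily_isNatural` is the equal-model case).
[cite: LeeSmoothManifolds2013, Thm. 18.14] -/
theorem integrationDeRhamIsoFamily_map_of_contMDiff [SigmaCompactSpace M] [SigmaCompactSpace N]
    {f : M → N} (hf : ContMDiff 𝓘(ℝ, E) 𝓘(ℝ, E') ∞ f) (k : ℕ) (c : deRhamCohomology 𝓘(ℝ, E') N ℝ k) :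
    integrationDeRhamIsoFamily E M k (deRhamCohomology.map hf k c) =
      singularCohomology.map ℝ ℝ ⟨f, hf.continuous⟩ k (integrationDeRhamIsoFamily E' N k c) := by
  rw [integrationDeRhamIsoFamily_apply, integrationDeRhamIsoFamily_apply]
  change (deRhamComparisonIso 𝓘(ℝ, E) M k).hom
      (deRhamToLocal 𝓘(ℝ, E) M ℝ k (deRhamCohomology.map hf k c)) =
    singularCohomology.map ℝ ℝ ⟨f, hf.continuous⟩ k
      ((deRhamComparisonIso 𝓘(ℝ, E') N k).hom (deRhamToLocal 𝓘(ℝ, E') N ℝ k c))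
  rw [deRhamToLocal_map, ← ModuleCat.comp_apply, ← ModuleCat.comp_apply,
    homologyMap_pullbackUniv_comp_deRhamComparisonIso_of_contMDiff hf k]

end DeRhamNatural

/-! ### A nowhere-vanishing top form is not exact -/

section TopForm

open scoped EuclideanSpace
open Filter

variable {n : ℕ} {M : Type*} [TopologicalSpace M] [ChartedSpace (EuclideanSpace ℝ (Fin n)) M]
  [IsManifold (𝓡 n) ∞ M]

/-- A de Rham class `[α]` vanishes only if `α` is exact (Warner (1983), Def. 4.11). [folklore] -/
theorem mem_exactSmoothForms_of_mk_eq_zero {E : Type*} [NormedAddCommGroup E] [NormedSpace ℝ E]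
    {H : Type*} [TopologicalSpace H] {I : ModelWithCorners ℝ E H} {X : Type*} [TopologicalSpace X]
    [ChartedSpace H X] {F : Type*} [NormedAddCommGroup F] [NormedSpace ℝ F] {k : ℕ}
    (α : closedSmoothForms I X F k) (h : deRhamCohomology.mk α = 0) :
    (α : MForm I X F k) ∈ exactSmoothForms I X F k := by
  have h1 : deRhamCohomology.mk α = deRhamCohomology.mk 0 := h.trans (map_zero _).symm
  have h2 := (deRhamCohomology.mk_eq_mk_iff α 0).1 h1
  rwa [Submodule.coe_zero, sub_zero] at h2

/-- **A nowhere-vanishing smooth top-degree form on a compact manifold is not exact**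
(Lee (2013), Prop. 15.5, Prop. 16.6(c), Cor. 16.13: the form orients `M` — here by the ray of
the form itself, continuous since the chart representative of a smooth form is continuous at
the centre — its integral is then positive (`MForm.integral_pos_of_sign_mul_apply_nonneg`),
while exact forms integrate to zero by Stokes
(`MForm.integral_eq_zero_of_mem_exactSmoothForms_holds`)).
[cite: LeeSmoothManifolds2013, Prop. 15.5 and Prop. 16.6] -/
theorem _root_.Literature.Geometry.Kaehler.MForm.not_mem_exactSmoothForms_of_forall_ne_zero
    [T2Space M] [CompactSpace M] [Nonempty M]
    {t : MForm (𝓡 n) M ℝ n} (ht : IsSmoothForm t) (hne : ∀ x, t x ≠ 0) :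
    t ∉ exactSmoothForms (𝓡 n) M ℝ n := by
  set e : Module.Basis (Fin n) ℝ (EuclideanSpace ℝ (Fin n)) :=
    modelBasis (EuclideanSpace ℝ (Fin n)) n
  -- the form is non-zero on the reference frame and as an alternating map
  have hc : ∀ x, t x ⇑e ≠ 0 := fun x h ↦ hne x <| by
    have h2 : (t x).toAlternatingMap = 0 :=
      (AlternatingMap.map_basis_eq_zero_iff e (t x).toAlternatingMap).1 h
    exact ContinuousAlternatingMap.toAlternatingMap_injective
      (h2.trans ContinuousAlternatingMap.toAlternatingMap_zero.symm)
  have h0 : ∀ x, (t x).toAlternatingMap ≠ 0 := fun x h ↦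
    hne x (ContinuousAlternatingMap.toAlternatingMap_injective
      (h.trans ContinuousAlternatingMap.toAlternatingMap_zero.symm))
  -- the orientation family of the form
  set o : (x : M) → _root_.Orientation ℝ (TangentSpace (𝓡 n) x) (Fin n) :=
    fun x ↦ rayOfNeZero ℝ _ (h0 x) with ho_def
  have hsign : ∀ (x₀ : M) (y : EuclideanSpace ℝ (Fin n)),
      chartSign o x₀ y = Real.sign (t.inChart x₀ y ⇑e) := by
    intro x₀ y
    simp only [ho_def, chartSign]
    rw [sign_someVector_rayOfNeZero]
    rfl
  have hsign' : ∀ x : M,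
      Real.sign (orientationForm o x ⇑e) = Real.sign (t x ⇑e) := fun x ↦
    sign_someVector_rayOfNeZero (t x).toAlternatingMap (h0 x) ⇑e
  -- continuity of the orientation family
  have ho : IsContinuousOrientation o := by
    intro x₀
    have hg : ContinuousWithinAt (fun y ↦ t.inChart x₀ y ⇑e) (range (𝓡 n))
        (extChartAt (𝓡 n) x₀ x₀) :=
      (continuous_eval_const (⇑e : Fin n → EuclideanSpace ℝ (Fin n))).continuousAt
        |>.comp_continuousWithinAt (ht x₀).continuousWithinAt
    have hg0 : t.inChart x₀ (extChartAt (𝓡 n) x₀ x₀) ⇑e ≠ 0 := by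
      rw [MForm.inChart_apply_self]
      exact hc x₀
    have hev : ∀ᶠ y in 𝓝[range (𝓡 n)] (extChartAt (𝓡 n) x₀ x₀),
        0 < t.inChart x₀ y ⇑(modelBasis (EuclideanSpace ℝ (Fin n)) n) *
          t.inChart x₀ (extChartAt (𝓡 n) x₀ x₀) ⇑(modelBasis (EuclideanSpace ℝ (Fin n)) n) :=
      (hg.tendsto.mul_const _).eventually (lt_mem_nhds (mul_self_pos.2 hg0))
    filter_upwards [hev] with y hy
    rw [hsign, hsign]
    rcases pos_and_pos_or_neg_and_neg_of_mul_pos hy with ⟨ha, hb⟩ | ⟨ha, hb⟩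
    · rw [Real.sign_of_pos ha, Real.sign_of_pos hb]
      exact ⟨rfl, one_ne_zero⟩
    · rw [Real.sign_of_neg ha, Real.sign_of_neg hb]
      exact ⟨rfl, neg_ne_zero.2 one_ne_zero⟩
  -- positivity of the integral, and Stokes
  have hpos : 0 < t.integral o := by
    refine MForm.integral_pos_of_sign_mul_apply_nonneg ho ht (fun x ↦ ?_) ?_
    · have h := abs_nonneg (t x ⇑(modelBasis (EuclideanSpace ℝ (Fin n)) n))
      rw [← real_sign_mul_self, ← hsign' x] at h
      exact h
    · obtain ⟨x⟩ := ‹Nonempty M›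
      refine ⟨x, ?_⟩
      have h := abs_pos.2 (hc x)
      rw [← real_sign_mul_self, ← hsign' x] at h
      exact h
  intro hex
  exact hpos.ne' (MForm.integral_eq_zero_of_mem_exactSmoothForms_holds o ho hex)

/-- The de Rham class of a nowhere-vanishing smooth closed top form on a compact manifold is
non-zero (Lee (2013), Thm. 17.31 / Cor. 16.13). [cite: LeeSmoothManifolds2013, Thm. 17.31] -/
theorem deRhamCohomology_mk_ne_zero_of_forall_ne_zero [T2Space M] [CompactSpace M] [Nonempty M]
    {t : MForm (𝓡 n) M ℝ n} (ht : t ∈ closedSmoothForms (𝓡 n) M ℝ n) (hne : ∀ x, t x ≠ 0) :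
    deRhamCohomology.mk ⟨t, ht⟩ ≠ 0 := fun h0 ↦
  MForm.not_mem_exactSmoothForms_of_forall_ne_zero ht.1 hne (mem_exactSmoothForms_of_mk_eq_zero _ h0)

end TopForm

/-! ### Top homology over a field of characteristic zero is spanned by `[M] ⊗ 1` -/

section Algebra

open CategoryTheory

-- see "Implementation notes" in `…SingularHomology.SingularChainsConcrete`
set_option backward.isDefEq.respectTransparency false

variable (K : Type) [Field K] {M : Type} [TopologicalSpace M]

/-- The change of coefficients of chains along `algebraMap ℤ K` is the base change of
`IntegralLattice` (two names for one map). [folklore] -/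
theorem chainCoeffChange_algebraMap_eq_baseChangeChain (k : ℕ) :
    chainCoeffChange (X := M) (algebraMap ℤ K : ℤ →+* K).toAddMonoidHom k = baseChangeChain ℤ K k :=
  rfl

/-- **`⟨β ⊗ 1, z ⊗ 1⟩ = ⟨β, z⟩`** for the change of coefficients `ℤ → K` on cohomology
(`singularCohomology.ringChange`) and homology (`singularHomology.coeffChange`) classes
(Hatcher (2002), §3.1 p. 198; the class-level form of the tree's
`kroneckerPairing_ringChange_eq_cast`). [cite: HatcherAT2002, §3.1 p. 198] -/
theorem kroneckerPairing_ringChange_coeffChange {k : ℕ} (β : singularCohomology ℤ ℤ M k)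
    (z : singularHomology ℤ ℤ M k) :
    kroneckerPairing K K M k (singularCohomology.ringChange (algebraMap ℤ K) M k β)
        (singularHomology.coeffChange M (algebraMap ℤ K : ℤ →+* K).toAddMonoidHom k z) =
      algebraMap ℤ K (kroneckerPairing ℤ ℤ M k β z) := by
  induction β using singularCohomology_induction_on with
  | h a =>
    induction z using singularHomology_induction_on with
    | h zc =>
      rw [singularHomology.coeffChange_homologyπ]
      exact kroneckerPairing_ringChange_eq_cast K a zc _ (by
        rw [iCycles_cyclesCoeffChange, chainCoeffChange_algebraMap_eq_baseChangeChain])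

variable {n : ℕ} [T2Space M] [CompactSpace M] [ConnectedSpace M]
  [ChartedSpace (EuclideanSpace ℝ (Fin n)) M]

/-- The fundamental class of a closed connected `ℤ`-oriented manifold is non-zero (it restricts
to the generator `μₓ ≠ 0` of `Hₙ(M | x; ℤ) ≅ ℤ`; Hatcher (2002), Thm. 3.26(a)).
[cite: HatcherAT2002, §3.3 Thm. 3.26(a)] -/
theorem fundamentalClass_ne_zero (μ : HomologicalOrientation ℤ M n) : μ.fundamentalClass ≠ 0 := by
  obtain ⟨x⟩ := (inferInstance : Nonempty M)
  intro h0
  have h1 := HomologicalOrientation.isFundamentalClass_fundamentalClass_holds (R := ℤ) (X := M) n μ x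
  rw [h0, map_zero] at h1
  obtain ⟨e, he⟩ := μ.isGenerator x
  rw [← h1, map_zero] at he
  exact zero_ne_one he

/-- There is an integral class `β ∈ Hⁿ(M; ℤ)` with `⟨β, [M]⟩ ≠ 0` (`Hₙ(M; ℤ) ≅ ℤ`,
Hatcher (2002), Thm. 3.26(a), and the Kronecker map is onto `Hom(Hₙ, ℤ)`, Thm. 3.2).
[cite: HatcherAT2002, §3.3 Thm. 3.26(a) and §3.1 Thm. 3.2] -/
theorem exists_kroneckerPairing_fundamentalClass_ne_zero (μ : HomologicalOrientation ℤ M n) :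
    ∃ β : singularCohomology ℤ ℤ M n, kroneckerPairing ℤ ℤ M n β μ.fundamentalClass ≠ 0 := by
  obtain ⟨e⟩ := nonempty_singularHomology_top_iso_holds (R := ℤ) (X := M) n μ
  set f : singularHomology ℤ ℤ M n →ₗ[ℤ] ℤ :=
    (ULift.moduleEquiv (R := ℤ) (M := ℤ)).toLinearMap ∘ₗ e.toLinearEquiv.toLinearMap with hf
  obtain ⟨β, hβ⟩ := kroneckerPairing_surjective ℤ M n f
  refine ⟨β, ?_⟩
  rw [hβ, hf]
  intro h0
  have h1 : e.toLinearEquiv μ.fundamentalClass = 0 := by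
    apply (ULift.moduleEquiv (R := ℤ) (M := ℤ)).injective
    rw [map_zero]
    exact h0
  exact fundamentalClass_ne_zero μ ((LinearEquiv.map_eq_zero_iff _).1 h1)

variable [CharZero K]

/-- **`[M] ⊗ 1 ≠ 0` in `Hₙ(M; K)`** for a closed connected `ℤ`-oriented `n`-manifold and a field
`K` of characteristic zero: an integral class `β` with `⟨β, [M]⟩ ≠ 0` has
`⟨β ⊗ 1, [M] ⊗ 1⟩ = ⟨β, [M]⟩ ≠ 0` (Hatcher (2002), §3.1 p. 198 with Thm. 3.26(a)).
[cite: HatcherAT2002, §3.1 p. 198] -/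
theorem coeffChange_fundamentalClass_ne_zero (μ : HomologicalOrientation ℤ M n) :
    singularHomology.coeffChange M (algebraMap ℤ K : ℤ →+* K).toAddMonoidHom n μ.fundamentalClass ≠ 0 := by
  obtain ⟨β, hβ⟩ := exists_kroneckerPairing_fundamentalClass_ne_zero μ
  intro h0
  have h1 := kroneckerPairing_ringChange_coeffChange K β μ.fundamentalClass
  rw [h0, map_zero] at h1
  exact hβ ((algebraMap ℤ K).injective_int (by rw [map_zero]; exact h1.symm))

omit [CharZero K] in
/-- **`dim_K Hₙ(M; K) = 1`** for a closed connected `ℤ`-oriented `n`-manifold: `M` is `K`-oriented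
by `μ ⊗ 1` (Hatcher (2002), p. 235, the tree's `HomologicalOrientation.toCoeff`) and
`Hₙ(M; K) ≅ K` (Thm. 3.26(a)). [cite: HatcherAT2002, §3.3 Thm. 3.26(a) and p. 235] -/
theorem finrank_singularHomology_top_eq_one (μ : HomologicalOrientation ℤ M n) :
    Module.finrank K (singularHomology K K M n) = 1 := by
  obtain ⟨e⟩ := nonempty_singularHomology_top_iso_holds (R := K) (X := M) n (μ.toCoeff K)
  rw [(e.toLinearEquiv.trans (ULift.moduleEquiv (R := K) (M := K))).finrank_eq, Module.finrank_self]

/-- Every class of `Hₙ(M; K)` is a multiple of `[M] ⊗ 1` (the line `Hₙ(M; K)` is spanned by the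
non-zero vector `[M] ⊗ 1`; Hatcher (2002), Thm. 3.26(a)). [cite: HatcherAT2002, §3.3 Thm. 3.26(a)] -/
theorem exists_eq_smul_coeffChange_fundamentalClass (μ : HomologicalOrientation ℤ M n)
    (z : singularHomology K K M n) :
    ∃ r : K, z = r • singularHomology.coeffChange M (algebraMap ℤ K : ℤ →+* K).toAddMonoidHom n
      μ.fundamentalClass := by
  obtain ⟨r, hr⟩ := (finrank_eq_one_iff_of_nonzero' _ (coeffChange_fundamentalClass_ne_zero K μ)).1
    (finrank_singularHomology_top_eq_one K μ) z
  exact ⟨r, hr.symm⟩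

/-- **Top-degree classes over a field of characteristic zero are detected by the fundamental
class**: on a closed connected `ℤ`-oriented `n`-manifold, a class `a ∈ Hⁿ(M; K)` with
`⟨a, [M] ⊗ 1⟩ = 0` is zero (`[M] ⊗ 1` spans `Hₙ(M; K)`, and the Kronecker map
`Hⁿ(M; K) → Hom(Hₙ(M; K), K)` is injective over a field, Hatcher (2002), Thm. 3.2 / p. 198).
[cite: HatcherAT2002, §3.1 Thm. 3.2 and p. 198; §3.3 Thm. 3.26(a)] -/
theorem eq_zero_of_kroneckerPairing_coeffChange_fundamentalClass_eq_zero
    (μ : HomologicalOrientation ℤ M n) {a : singularCohomology K K M n}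
    (h : kroneckerPairing K K M n a (singularHomology.coeffChange M
      (algebraMap ℤ K : ℤ →+* K).toAddMonoidHom n μ.fundamentalClass) = 0) :
    a = 0 := by
  refine kroneckerPairing_injective_of_field K M n ?_
  rw [map_zero]
  ext z
  obtain ⟨r, rfl⟩ := exists_eq_smul_coeffChange_fundamentalClass K μ z
  rw [map_smul, h, smul_zero, LinearMap.zero_apply]

end Algebra

/-! ### The pairing of a nowhere-vanishing top form with the fundamental class -/

section Pairing

open scoped EuclideanSpace

/-- **`⟨e_M [t], [M] ⊗ 1⟩ ≠ 0` for a nowhere-vanishing smooth closed top form `t`** on a closed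
connected smooth `n`-manifold `M` with any `ℤ`-orientation `μ` (`[M] = μ.fundamentalClass`,
`e_M` the integration isomorphism `Hⁿ_dR(M) ≃ Hⁿ(M; ℝ)`): `[t] ≠ 0` because `t` is not exact
(Stokes), so `e_M [t] ≠ 0`, and `Hⁿ(M; ℝ)` is detected by `[M] ⊗ 1` (Bott–Tu (1982), §I.5–6;
Lee (2013), Thm. 17.31 with Thm. 18.14). Both orientations `±μ` qualify (the statement is
sign-free). [cite: LeeSmoothManifolds2013, Thm. 17.31 and Thm. 18.14] -/
theorem kroneckerPairing_integrationDeRham_fundamentalClass_ne_zero {n : ℕ} {M : Type}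
    [TopologicalSpace M] [T2Space M] [CompactSpace M] [ConnectedSpace M]
    [ChartedSpace (EuclideanSpace ℝ (Fin n)) M] [IsManifold (𝓡 n) ∞ M]
    (μ : HomologicalOrientation ℤ M n) {t : MForm (𝓡 n) M ℝ n}
    (ht : t ∈ closedSmoothForms (𝓡 n) M ℝ n) (hne : ∀ x, t x ≠ 0) :
    kroneckerPairing ℝ ℝ M n
        (integrationDeRhamIsoFamily (EuclideanSpace ℝ (Fin n)) M n (deRhamCohomology.mk ⟨t, ht⟩))
        (singularHomology.coeffChange M (algebraMap ℤ ℝ : ℤ →+* ℝ).toAddMonoidHom n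
          μ.fundamentalClass) ≠ 0 := by
  have hmk : deRhamCohomology.mk ⟨t, ht⟩ ≠ 0 := deRhamCohomology_mk_ne_zero_of_forall_ne_zero ht hne
  have he : integrationDeRhamIsoFamily (EuclideanSpace ℝ (Fin n)) M n (deRhamCohomology.mk ⟨t, ht⟩) ≠ 0 :=
    fun h0 ↦ hmk ((LinearEquiv.map_eq_zero_iff _).1 h0)
  exact fun h0 ↦ he (eq_zero_of_kroneckerPairing_coeffChange_fundamentalClass_eq_zero ℝ μ h0)

variable {k : ℕ} {S : Type} [TopologicalSpace S] [T2Space S] [CompactSpace S] [ConnectedSpace S]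
  [ChartedSpace (EuclideanSpace ℝ (Fin k)) S] [IsManifold (𝓡 k) ∞ S]
  {E' : Type} [NormedAddCommGroup E'] [NormedSpace ℝ E'] [FiniteDimensional ℝ E']
  {N : Type} [TopologicalSpace N] [ChartedSpace E' N] [IsManifold 𝓘(ℝ, E') ∞ N] [T2Space N]
  [SigmaCompactSpace N]

/-- **Mapped form.** For a `C^∞` map `f : S → N` from a closed connected `k`-manifold `S` (any
`ℤ`-orientation `μS`) to a manifold `N` and a closed smooth `k`-form `s` on `N` whose pull-back
`f^* s` vanishes nowhere on `S`, `⟨e_N [s], f_* ([S] ⊗ 1)⟩ = ⟨e_S [f^* s], [S] ⊗ 1⟩ ≠ 0`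
(naturality of `e`, Lee (2013), Thm. 18.14, and of the Kronecker pairing; then
`kroneckerPairing_integrationDeRham_fundamentalClass_ne_zero`). This is how McDuff–Salamon (2017)
see that a symplectic surface carries a non-trivial real homology class (`∫_Σ ω > 0`, Ex. 4.4.5 /
proof of Thm. 13.3.11). [cite: McDuffSalamon2017, Ex. 4.4.5] -/
theorem kroneckerPairing_integrationDeRham_map_fundamentalClass_ne_zero
    (μS : HomologicalOrientation ℤ S k) {f : S → N} (hf : ContMDiff (𝓡 k) 𝓘(ℝ, E') ∞ f)
    (s : closedSmoothForms 𝓘(ℝ, E') N ℝ k) (hne : ∀ y, (s : MForm 𝓘(ℝ, E') N ℝ k).pullback (𝓡 k) f y ≠ 0) :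
    kroneckerPairing ℝ ℝ N k (integrationDeRhamIsoFamily E' N k (deRhamCohomology.mk s))
        (singularHomology.map ℝ ℝ ⟨f, hf.continuous⟩ k
          (singularHomology.coeffChange S (algebraMap ℤ ℝ : ℤ →+* ℝ).toAddMonoidHom k
            μS.fundamentalClass)) ≠ 0 := by
  haveI : LocallyCompactSpace S := ChartedSpace.locallyCompactSpace (EuclideanSpace ℝ (Fin k)) S
  haveI : SecondCountableTopology S :=
    ChartedSpace.secondCountable_of_sigmaCompact (EuclideanSpace ℝ (Fin k)) S
  haveI : LocallyCompactSpace N := ChartedSpace.locallyCompactSpace E' N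
  haveI : SecondCountableTopology N := ChartedSpace.secondCountable_of_sigmaCompact E' N
  rw [← kroneckerPairing_map, ← integrationDeRhamIsoFamily_map_of_contMDiff hf k,
    deRhamCohomology.map_mk]
  exact kroneckerPairing_integrationDeRham_fundamentalClass_ne_zero μS
    (pullback_mem_closedSmoothForms hf s.2) hne

/-- A torsion element of a `ℤ`-module is killed by a non-zero integer (for any `ℤ`-module
structure, read off the hypothesis; the conclusion is about the canonical `ℤ`-action). [folklore] -/
theorem exists_zsmul_eq_zero_of_mem_torsion {A : Type*} [AddCommGroup A] {inst : Module ℤ A} {x : A}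
    (hx : x ∈ @Submodule.torsion ℤ A _ _ inst) : ∃ m : ℤ, m ≠ 0 ∧ m • x = 0 := by
  obtain ⟨⟨m, hm⟩, hmx⟩ := (Submodule.mem_torsion_iff x).1 hx
  refine ⟨m, nonZeroDivisors.ne_zero hm, ?_⟩
  rw [← Int.cast_smul_eq_zsmul ℤ m x]
  exact hmx

/-- **A closed connected `k`-manifold mapped into `N` so that some closed `k`-form of `N` pulls
back to a nowhere-vanishing form carries a non-torsion class**: `f_* [S] ∈ Hₖ(N; ℤ)` is not a
torsion element (if `m • f_* [S] = 0` with `m ≠ 0`, then `f_* ([S] ⊗ 1) = (f_* [S]) ⊗ 1 = 0` in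
`Hₖ(N; ℝ)`, contradicting `kroneckerPairing_integrationDeRham_map_fundamentalClass_ne_zero`).
McDuff–Salamon (2017), Ex. 4.4.5 / proof of Thm. 13.3.11 (a symplectic surface "has
`∫_Σ ω > 0`, hence represents a non-torsion homology class"). [cite: McDuffSalamon2017, Ex. 4.4.5] -/
theorem map_fundamentalClass_not_mem_torsion
    (μS : HomologicalOrientation ℤ S k) {f : S → N} (hf : ContMDiff (𝓡 k) 𝓘(ℝ, E') ∞ f)
    (s : closedSmoothForms 𝓘(ℝ, E') N ℝ k) (hne : ∀ y, (s : MForm 𝓘(ℝ, E') N ℝ k).pullback (𝓡 k) f y ≠ 0) :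
    singularHomology.map ℤ ℤ ⟨f, hf.continuous⟩ k μS.fundamentalClass ∉
      Submodule.torsion ℤ (singularHomology ℤ ℤ N k) := by
  intro hmem
  obtain ⟨m, hm0, hmx⟩ := exists_zsmul_eq_zero_of_mem_torsion hmem
  set ι := singularHomology.coeffChange N (algebraMap ℤ ℝ : ℤ →+* ℝ).toAddMonoidHom k with hι
  -- `(m • f_*[S]) ⊗ 1 = m • f_* ([S] ⊗ 1) = 0`
  have h2 : m • ι (singularHomology.map ℤ ℤ ⟨f, hf.continuous⟩ k μS.fundamentalClass) = 0 := by
    rw [← map_zsmul ι, hmx, map_zero]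
  rw [hι, singularHomology.coeffChange_map, ← Int.cast_smul_eq_zsmul ℝ m] at h2
  have h3 : singularHomology.map ℝ ℝ ⟨f, hf.continuous⟩ k
      (singularHomology.coeffChange S (algebraMap ℤ ℝ : ℤ →+* ℝ).toAddMonoidHom k
        μS.fundamentalClass) = 0 := by
    rcases smul_eq_zero.1 h2 with h | h
    · exact absurd (Int.cast_eq_zero.1 h) hm0
    · exact h
  refine kroneckerPairing_integrationDeRham_map_fundamentalClass_ne_zero μS hf s hne ?_
  rw [h3, map_zero]

end Pairing

end Literature.Geometry.Manifold
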